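import Mathlib
import Summits.KontsevichZagierPeriods.Zeta5Search.MomentVanishing
import HarnessLib

/-!
# ζ(5) search — `MomentIntegral` is a THEOREM: the moments `μ_N(b)` of `R_b` at infinity are INTEGERS

Cell `pub-zeta5` (HONEST FRAMING: systematic search; no irrationality claim unless certified), typer seat
generation 7.  Discharges BY NAME the statement `ClusterValuation.MomentIntegral` of gen-2 g8's statement file
(`ClusterValuationResidues.lean`): for `b` in the Brown–Zudilin polytope, every prime `p` and every `N`,
`v_p(μ_N(b)) ≥ 0`.  We prove the stronger `momentAt_eq_intCast : ∃ z : ℤ, μ_N(b) = z` (g8 conjectured `ℤ[1/2]`;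
the factor `2y + b₀` of `numPoly` is already integral, so no `2` is lost).  Together with `MomentVanishing.lean`
this settles the two "moment lemmas" among the four hypotheses of g8's reduction `casoratianValuationLaw_of`;
the two floor laws (`ConstantTermFloorLaw`, `KResCasoratianLaw`) remain observed.  An integrality statement about
rational numbers; nothing about irrationality.

PROOF.  From `MomentVanishing.lean`: `Q·M = X·P₁ = X^{6n+6−D}·G` in `ℚ⟦X⟧` with `M` the moment series
(`[X^N] M = μ_N`, `N ≥ 1`), `Q = ∏_{s≤n}(1+(s+1)X)^6` and `G = revNum b D` the reversed shifted numerator.  Here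
(i) `numPoly b = (2X+b₀)·∏(X+k)` lifts to `ℤ[X]` (`numPoly_mem_lifts`), hence so does `G` (`revNum_eq_map`);
(ii) `Q⁻¹ = ∏ invLin(s+1)^6` with `invLin k = Σ (−k)^m X^m ∈ ℤ⟦X⟧` (`poleSeries_mul_prod_invLin`, `prod_invLin_eq_map`);
so `M = Q⁻¹·X^{6n+6−D}·G` is the image of an integer power series (`exists_map_eq_momentSeries`) and every `μ_N ∈ ℤ`
(`μ_0 = μ_1` by truncated subtraction, `momentAt_zero`).

SHARPNESS (`momentAt_sharp`): the window of `MomentVanishing` is exact — `μ_{2d(b)+5}(b) = 2`, the leading coefficient of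
`numPoly` (`natDegree_numPoly`: degree exactly `1 + 2Σβ_j`, leading coefficient `2`; `Q⁻¹(0) = 1`).
-/

open Finset

namespace Summit.KontsevichZagierPeriods.Zeta5Search.BigPrime

open Polynomial
open Summit.KontsevichZagierPeriods.Zeta5Search.DualSeries (InBox numPoly natDegree_numPoly_le)
open Summit.KontsevichZagierPeriods.Zeta5Search.WedgeDictionary (IsPFData pfData isPFData_pfData exists_isPFData dOf)
open Summit.KontsevichZagierPeriods.Zeta5Search.CasoratianValuation (InPolytope)
open Summit.KontsevichZagierPeriods.Zeta5Search.ClusterValuation (momentAt MomentIntegral)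

/-! ## `numPoly ∈ ℤ[X]`, `Q⁻¹ ∈ ℤ⟦X⟧`, hence `M ∈ ℤ⟦X⟧` -/

/-- `numPoly b` has integer coefficients (it lifts along `ℤ → ℚ`): it is `(2X + b₀)` times Pochhammer factors
`∏ (X + k)` with integer `k`. -/
theorem numPoly_mem_lifts (b : ℕ → ℤ) : numPoly b ∈ Polynomial.lifts (Int.castRingHom ℚ) := by
  unfold numPoly Literature.NumberTheory.Transcendental.BallRivoal.pochPoly
  refine Subsemiring.mul_mem _ (Subsemiring.add_mem _ (Subsemiring.mul_mem _ (C'_mem_lifts ⟨2, by simp⟩)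
    (X_mem_lifts _)) (C'_mem_lifts ⟨b 0, by simp⟩)) (Subsemiring.prod_mem _ fun j _ => Subsemiring.mul_mem _
      (Subsemiring.prod_mem _ fun s _ => Subsemiring.add_mem _ (X_mem_lifts _) (C'_mem_lifts ⟨s, by simp⟩))
      (Subsemiring.prod_mem _ fun s _ => Subsemiring.add_mem _ (X_mem_lifts _)
        (C'_mem_lifts ⟨b 0 - b (j + 1) + 1 + s, by simp⟩)))

/-- `Q · Q⁻¹ = 1` with the explicit inverse `Q⁻¹ = ∏_{s ≤ n} invLin(s+1)^6`. -/
theorem poleSeries_mul_prod_invLin (n : ℕ) :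
    poleSeries n * ∏ s ∈ range (n + 1), invLin ((s : ℚ) + 1) ^ 6 = 1 := by
  rw [poleSeries, ← prod_mul_distrib]
  refine prod_eq_one fun s _ => ?_
  rw [← mul_pow, one_add_mul_invLin, one_pow]

/-- `Q⁻¹` is the image of an integer power series. -/
theorem prod_invLin_eq_map (n : ℕ) :
    ∏ s ∈ range (n + 1), invLin ((s : ℚ) + 1) ^ 6 =
      PowerSeries.map (Int.castRingHom ℚ)
        (∏ s ∈ range (n + 1), (PowerSeries.mk fun m => (-((s : ℤ) + 1)) ^ m) ^ 6) := by
  rw [map_prod]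
  refine prod_congr rfl fun s _ => ?_
  rw [map_pow]
  congr 1
  ext m
  simp [invLin, PowerSeries.coeff_map, PowerSeries.coeff_mk]

/-- The reversed numerator is the image of an integer polynomial. -/
theorem revNum_eq_map (b : ℕ → ℤ) (D : ℕ) :
    ∃ G : ℤ[X], revNum b D = G.map (Int.castRingHom ℚ) := by
  obtain ⟨P, hP⟩ := (mem_lifts _).1 (numPoly_mem_lifts b)
  refine ⟨∑ i ∈ range (D + 1), C ((P.comp (X + C 1)).coeff i) * X ^ (D - i), ?_⟩
  have hcomp : (numPoly b).comp (X + C 1) = (P.comp (X + C 1)).map (Int.castRingHom ℚ) := by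
    rw [Polynomial.map_comp, hP, Polynomial.map_add, Polynomial.map_X, Polynomial.map_C, eq_intCast, Int.cast_one]
  rw [revNum, hcomp, Polynomial.map_sum]
  refine sum_congr rfl fun i _ => ?_
  rw [Polynomial.map_mul, Polynomial.map_pow, Polynomial.map_X, Polynomial.map_C, Polynomial.coeff_map]

/-- **The moment series is the image of an integer power series** (data of `R_b`, `deg numPoly ≤ D ≤ 6n+5`). -/
theorem exists_map_eq_momentSeries (b : ℕ → ℤ) {c : ℕ → ℕ → ℚ} (hc : IsPFData b c) {D : ℕ}
    (hD : (numPoly b).natDegree ≤ D) (hDn : D ≤ 6 * (b 0).toNat + 5) :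
    ∃ ψ : PowerSeries ℤ, PowerSeries.map (Int.castRingHom ℚ) ψ = momentSeries (b 0).toNat c := by
  set n := (b 0).toNat with hn
  obtain ⟨G, hG⟩ := revNum_eq_map b D
  have hQM := poleSeries_mul_momentSeries n c
  rw [← coe_reflPoly, reflPoly_eq b hc hD hDn, Polynomial.coe_mul, Polynomial.coe_pow, Polynomial.coe_X,
    ← mul_assoc, ← pow_succ'] at hQM
  have hM : momentSeries n c = (∏ s ∈ range (n + 1), invLin ((s : ℚ) + 1) ^ 6) *
      (PowerSeries.X ^ (6 * n + 5 - D + 1) * (revNum b D : PowerSeries ℚ)) := by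
    rw [← hQM, ← mul_assoc, mul_comm (∏ s ∈ range (n + 1), invLin ((s : ℚ) + 1) ^ 6) (poleSeries n),
      poleSeries_mul_prod_invLin, one_mul]
  refine ⟨(∏ s ∈ range (n + 1), (PowerSeries.mk fun m => (-((s : ℤ) + 1)) ^ m) ^ 6) *
      (PowerSeries.X ^ (6 * n + 5 - D + 1) * (G : PowerSeries ℤ)), ?_⟩
  rw [hM, map_mul, map_mul, map_pow, PowerSeries.map_X, ← prod_invLin_eq_map, hG,
    Polynomial.polynomial_map_coe]

/-- `μ_0(b) = μ_1(b)` (an artefact of truncated subtraction in `momentAt`; both equal `Σ_q c_{0,q}`). -/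
theorem momentAt_zero (b : ℕ → ℤ) : momentAt b 0 = momentAt b 1 := by
  simp only [momentAt, Nat.zero_sub, Nat.sub_self]

/-- **The moments are INTEGERS**: for `b` in the polytope and every `N`, `μ_N(b) ∈ ℤ`
(`M = Q⁻¹ · X^{2d+5} · G` with `Q⁻¹ ∈ ℤ⟦X⟧`, `G ∈ ℤ[X]`). -/
theorem momentAt_eq_intCast (b : ℕ → ℤ) (hb : InPolytope b) (N : ℕ) : ∃ z : ℤ, momentAt b N = z := by
  obtain ⟨hbox, h2, h3⟩ := hb
  obtain ⟨c, hc⟩ := exists_isPFData b hbox (by omega)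
  have hpf := isPFData_pfData hc
  obtain ⟨e0, hS, hβ, hS3⟩ := polytope_data b hbox h2 h3
  have hD : (numPoly b).natDegree ≤ 1 + 2 * ∑ j ∈ range 7, (b (j + 1)).toNat := natDegree_numPoly_le b
  have hDn : 1 + 2 * ∑ j ∈ range 7, (b (j + 1)).toNat ≤ 6 * (b 0).toNat + 5 := by omega
  obtain ⟨ψ, hψ⟩ := exists_map_eq_momentSeries b hpf hD hDn
  -- reduce `N = 0` to `N = 1`
  obtain ⟨N', hN', hNN'⟩ : ∃ N', 1 ≤ N' ∧ momentAt b N = momentAt b N' := by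
    rcases Nat.eq_zero_or_pos N with rfl | hN
    · exact ⟨1, le_rfl, momentAt_zero b⟩
    · exact ⟨N, hN, rfl⟩
  refine ⟨PowerSeries.coeff N' ψ, ?_⟩
  rw [hNN', momentAt, ← eq_intCast (Int.castRingHom ℚ), ← PowerSeries.coeff_map, hψ,
    coeff_momentSeries _ _ hN', sum_comm]

/-- **`MomentIntegral` is a THEOREM** (in the strong form `μ_N(b) ∈ ℤ`: `momentAt_eq_intCast`): `μ_N(b)` is
`p`-integral for every prime `p`. -/
theorem momentIntegral_holds : MomentIntegral := by
  intro b N p hb _ _ _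
  obtain ⟨z, hz⟩ := momentAt_eq_intCast b hb N
  rw [hz, padicValRat.of_int]
  positivity

/-! ## Sharpness: `μ_{2d+5}(b) = 2` -/

/-- Pochhammer polynomials are monic of degree `m`. -/
theorem monic_pochPoly (β : ℚ) (m : ℕ) :
    (Literature.NumberTheory.Transcendental.BallRivoal.pochPoly β m).Monic ∧
      (Literature.NumberTheory.Transcendental.BallRivoal.pochPoly β m).natDegree = m := by
  unfold Literature.NumberTheory.Transcendental.BallRivoal.pochPoly
  refine ⟨monic_prod_of_monic _ _ fun s _ => monic_X_add_C _, ?_⟩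
  rw [natDegree_prod_of_monic _ _ fun s _ => monic_X_add_C _]
  simp only [natDegree_X_add_C, sum_const, card_range, smul_eq_mul, mul_one]

/-- `numPoly b` has degree exactly `1 + 2Σ_j β_j` and leading coefficient `2`. -/
theorem natDegree_numPoly (b : ℕ → ℤ) :
    (numPoly b).natDegree = 1 + 2 * ∑ j ∈ range 7, (b (j + 1)).toNat ∧ (numPoly b).leadingCoeff = 2 := by
  have hlin : (C (2 : ℚ) * X + C ((b 0 : ℤ) : ℚ)).natDegree = 1 ∧
      (C (2 : ℚ) * X + C ((b 0 : ℤ) : ℚ)).leadingCoeff = 2 :=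
    ⟨natDegree_linear (by norm_num), leadingCoeff_linear (by norm_num)⟩
  have hm : ∀ j ∈ range 7,
      (Literature.NumberTheory.Transcendental.BallRivoal.pochPoly 0 (b (j + 1)).toNat *
        Literature.NumberTheory.Transcendental.BallRivoal.pochPoly ((b 0 - b (j + 1) + 1 : ℤ) : ℚ)
          (b (j + 1)).toNat).Monic :=
    fun j _ => (monic_pochPoly _ _).1.mul (monic_pochPoly _ _).1
  have hF := monic_prod_of_monic _ _ hm
  have hFdeg : (∏ j ∈ range 7,
      (Literature.NumberTheory.Transcendental.BallRivoal.pochPoly 0 (b (j + 1)).toNat *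
        Literature.NumberTheory.Transcendental.BallRivoal.pochPoly ((b 0 - b (j + 1) + 1 : ℤ) : ℚ)
          (b (j + 1)).toNat)).natDegree = 2 * ∑ j ∈ range 7, (b (j + 1)).toNat := by
    rw [natDegree_prod_of_monic _ _ hm, mul_sum]
    refine sum_congr rfl fun j _ => ?_
    rw [(monic_pochPoly _ _).1.natDegree_mul (monic_pochPoly _ _).1, (monic_pochPoly _ _).2,
      (monic_pochPoly _ _).2]
    ring
  have hne : (C (2 : ℚ) * X + C ((b 0 : ℤ) : ℚ)) ≠ 0 := by
    intro h
    have := congrArg natDegree h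
    rw [hlin.1, natDegree_zero] at this
    exact one_ne_zero this
  unfold numPoly
  exact ⟨by rw [natDegree_mul hne hF.ne_zero, hlin.1, hFdeg], by rw [leadingCoeff_mul, hlin.2, hF.leadingCoeff, mul_one]⟩

/-- The top coefficient of the shifted numerator `numPoly(X+1)` is `2`. -/
theorem coeff_comp_natDegree (b : ℕ → ℤ) :
    ((numPoly b).comp (X + C 1)).coeff (numPoly b).natDegree = 2 := by
  have hq : (X + C (1 : ℚ)).natDegree = 1 := natDegree_X_add_C 1
  have hd : ((numPoly b).comp (X + C 1)).natDegree = (numPoly b).natDegree := by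
    rw [natDegree_comp, hq, mul_one]
  have hl : ((numPoly b).comp (X + C 1)).leadingCoeff = 2 := by
    rw [leadingCoeff_comp (by rw [hq]; exact one_ne_zero), (natDegree_numPoly b).2,
      (monic_X_add_C (1 : ℚ)).leadingCoeff, one_pow, mul_one]
  rw [← hd]
  exact hl

/-- The constant coefficient of the reversed numerator is the `D`-th coefficient of `numPoly(X+1)`. -/
theorem coeff_zero_revNum (b : ℕ → ℤ) (D : ℕ) :
    (revNum b D).coeff 0 = ((numPoly b).comp (X + C 1)).coeff D := by
  rw [revNum, finsetSum_coeff, sum_eq_single_of_mem D (mem_range.2 (Nat.lt_succ_self D))]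
  · simp
  · intro i hi hiD
    have hne : (0 : ℕ) ≠ D - i := by have := mem_range.1 hi; omega
    simp [coeff_X_pow, hne]

/-- **Sharpness of `MomentVanishing`**: the first moment beyond the window is `μ_{2d(b)+5}(b) = 2`
(the leading coefficient of `numPoly`; `Q⁻¹(0) = 1`). -/
theorem momentAt_sharp (b : ℕ → ℤ) (hb : InPolytope b) : momentAt b (2 * (dOf b).toNat + 5) = 2 := by
  obtain ⟨hbox, h2, h3⟩ := hb
  obtain ⟨c, hc⟩ := exists_isPFData b hbox (by omega)
  have hpf := isPFData_pfData hc
  obtain ⟨e0, hS, hβ, hS3⟩ := polytope_data b hbox h2 h3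
  set n := (b 0).toNat with hn
  set D := 1 + 2 * ∑ j ∈ range 7, (b (j + 1)).toNat with hDdef
  have hdeg : (numPoly b).natDegree = D := (natDegree_numPoly b).1
  have hDn : D ≤ 6 * n + 5 := by omega
  have hd : dOf b = 3 * (n : ℤ) - ((∑ j ∈ range 7, (b (j + 1)).toNat : ℕ) : ℤ) := by rw [dOf, hS, e0]
  have hN : 2 * (dOf b).toNat + 5 = 6 * n + 5 - D + 1 := by rw [hd]; omega
  have hQM := poleSeries_mul_momentSeries n (pfData b)
  rw [← coe_reflPoly, reflPoly_eq b hpf hdeg.le hDn, Polynomial.coe_mul, Polynomial.coe_pow, Polynomial.coe_X,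
    ← mul_assoc, ← pow_succ'] at hQM
  have hM : momentSeries n (pfData b) = PowerSeries.X ^ (6 * n + 5 - D + 1) *
      ((∏ s ∈ range (n + 1), invLin ((s : ℚ) + 1) ^ 6) * (revNum b D : PowerSeries ℚ)) := by
    calc momentSeries n (pfData b)
        = (poleSeries n * ∏ s ∈ range (n + 1), invLin ((s : ℚ) + 1) ^ 6) * momentSeries n (pfData b) := by
          rw [poleSeries_mul_prod_invLin, one_mul]
      _ = (∏ s ∈ range (n + 1), invLin ((s : ℚ) + 1) ^ 6) * (poleSeries n * momentSeries n (pfData b)) := by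
          ring
      _ = _ := by rw [hQM]; ring
  have key : PowerSeries.coeff (6 * n + 5 - D + 1) (momentSeries n (pfData b)) = 2 := by
    rw [hM, PowerSeries.coeff_X_pow_mul', if_pos le_rfl, Nat.sub_self, PowerSeries.coeff_zero_eq_constantCoeff_apply,
      map_mul, Polynomial.constantCoeff_coe, coeff_zero_revNum, ← hdeg, coeff_comp_natDegree, map_prod,
      prod_eq_one (fun s _ => by
        rw [map_pow, invLin, ← PowerSeries.coeff_zero_eq_constantCoeff_apply, PowerSeries.coeff_mk, pow_zero,
          one_pow]), one_mul]
  have h1 : 1 ≤ 6 * n + 5 - D + 1 := by omega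
  rw [coeff_momentSeries _ _ h1, sum_comm] at key
  rw [hN, momentAt]
  exact key

end Summit.KontsevichZagierPeriods.Zeta5Search.BigPrime
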